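import Mathlib.Algebra.BigOperators.Group.Finset.Basic
import Mathlib.Algebra.Order.BigOperators.Group.Finset
import Mathlib.Data.Nat.Choose.Basic
import Mathlib.Order.Interval.Finset.Nat
import Mathlib.Tactic
import HarnessLib

/-!
# Venture HSemireg — the RANK LAW's window count and the ALL-`g` EQUATION COUNT of «TOWERS ≡ GRAPHS» (ENGINE-W code A, SERVICE (α), RUNG 3 (i);
# note `widen/ENGINE-W/out/p5alpha/P5-ALPHA-MOMENT-A.md` v1.17 §2 (B∞))

HONEST FRAMING. Lean index of the computation cell `pub-hsemireg`, widening group ENGINE-W (code A, seat `engine-w-1`, gen 19).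
ELEMENTARY COUNTING ONLY. (B∞) of the note proves by pencil, for EVERY `g ≥ 2`, that in the exterior-algebra model of the diagonal anchor the tower
admissibility system has, in the non-corner bidegree `(P,Q)`, rank `min(min(P,Q)+1, g+1−max(P,Q)) − [P = Q]` — the number of exponents `m` with
`max(0, P+Q−g) ≤ m ≤ min(P,Q)` (the basis classes `θ₁^m T₁₀^{P−m} T₀₁^{Q−m} T₀₀^{g−P−Q+m}`), less the one invariant direction on the diagonal — and that
the total number of independent equations is `(g³ + 6g² + 5g − 12)∕6 = (g−1)(g+3)(g+4)∕6` (t-4 g32's machine values 28 ∕ 75 ∕ 154 ∕ 273 at `g = 4 ∕ 6 ∕ 8 ∕ 10`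
and its conjectured formula, bus l.26135). What the kernel holds is the COUNTING half of that statement, for all `g`:
nothing about exterior algebras, invariants, towers, graphs or abelian varieties is formalised, and nothing here says that HC, HC_CM, HC_AV or DIAG(n,d) holds.
Theorems only (0 `def`, 0 named fact, 0 `sorry`). New namespace `TowerRankLaw`.

* `window_card` — for `P, Q ≤ g`: `#{m ≤ g : P+Q ≤ g+m ∧ m ≤ P ∧ m ≤ Q} = min (min P Q + 1) (g + 1 − max P Q)`. [kernel]
* `window_succ` — for `P, Q ≤ g` the window count at `g+1` exceeds the one at `g` by `[g+1 ≤ P+Q]`. [kernel]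
* `antitriangle_twice` — `2·Σ_{P,Q ≤ g} [g+1 ≤ P+Q] = g(g+1)`. [kernel]
* `six_sum_window` — `6·Σ_{P,Q ≤ g} min (min P Q + 1) (g + 1 − max P Q) = (g+1)(g+2)(g+3)` for every `g` (so the sum is `C(g+3,3)`). [kernel, induction on `g`]
* `six_total_rank` — for `g ≥ 1`: `6·Σ_{(P,Q) non-corner} (min (min P Q + 1) (g + 1 − max P Q) − [P = Q]) = g³ + 6g² + 5g − 12`. [kernel]
* `total_rank_values` — the instances `g = 4, 6, 8, 10`: `28, 75, 154, 273`, by direct kernel evaluation (independent of `six_total_rank`). [kernel, `decide`]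
-/

open Finset

namespace Summit.Ventures.HSemireg.TowerRankLaw

/-- **Window count = rank-law value.** For `P, Q ≤ g` the exponents `m ≤ g` with `P + Q ≤ g + m`, `m ≤ P`, `m ≤ Q` number
`min (min P Q + 1) (g + 1 - max P Q)`. [kernel] -/
theorem window_card (g P Q : ℕ) (hP : P ≤ g) (hQ : Q ≤ g) :
    ((range (g + 1)).filter (fun m => P + Q ≤ g + m ∧ m ≤ P ∧ m ≤ Q)).card = min (min P Q + 1) (g + 1 - max P Q) := by
  have h : (range (g + 1)).filter (fun m => P + Q ≤ g + m ∧ m ≤ P ∧ m ≤ Q) = Icc (P + Q - g) (min P Q) := by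
    ext m; simp only [mem_filter, mem_range, mem_Icc]; omega
  rw [h, Nat.card_Icc]; omega

/-- **Window step.** For `P, Q ≤ g` the rank-law value at `g + 1` is the value at `g` plus `[g + 1 ≤ P + Q]`. [kernel] -/
theorem window_succ (g P Q : ℕ) (hP : P ≤ g) (hQ : Q ≤ g) :
    min (min P Q + 1) (g + 2 - max P Q) = min (min P Q + 1) (g + 1 - max P Q) + (if g + 1 ≤ P + Q then 1 else 0) := by
  split_ifs <;> omega

/-- **Anti-triangle count, inner row.** For `P ≤ g`: `#{Q ≤ g : g + 1 ≤ P + Q} = P`. [kernel] -/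
theorem antitriangle_row (g P : ℕ) (hP : P ≤ g) :
    (∑ Q ∈ range (g + 1), (if g + 1 ≤ P + Q then 1 else 0)) = P := by
  rw [Finset.sum_boole]
  have h : (range (g + 1)).filter (fun Q => g + 1 ≤ P + Q) = Icc (g + 1 - P) g := by
    ext Q; simp only [mem_filter, mem_range, mem_Icc]; omega
  simp only [Nat.cast_id, h, Nat.card_Icc]; omega

/-- **Anti-triangle count.** `2 · Σ_{P,Q ≤ g} [g + 1 ≤ P + Q] = g (g + 1)`. [kernel] -/
theorem antitriangle_twice (g : ℕ) :
    2 * (∑ P ∈ range (g + 1), ∑ Q ∈ range (g + 1), (if g + 1 ≤ P + Q then 1 else 0)) = g * (g + 1) := by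
  have h : (∑ P ∈ range (g + 1), ∑ Q ∈ range (g + 1), (if g + 1 ≤ P + Q then 1 else 0)) = ∑ P ∈ range (g + 1), P := by
    refine Finset.sum_congr rfl ?_
    intro P hP
    exact antitriangle_row g P (by simpa [mem_range, Nat.lt_succ_iff] using hP)
  rw [h, mul_comm, Finset.sum_range_id_mul_two]
  simp [mul_comm]

/-- **All-`g` window sum** (`= C(g+3,3)`): `6 · Σ_{P,Q ≤ g} min (min P Q + 1) (g + 1 - max P Q) = (g + 1)(g + 2)(g + 3)`. [kernel, induction] -/
theorem six_sum_window (g : ℕ) :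
    6 * (∑ P ∈ range (g + 1), ∑ Q ∈ range (g + 1), min (min P Q + 1) (g + 1 - max P Q)) = (g + 1) * (g + 2) * (g + 3) := by
  induction g with
  | zero => decide
  | succ g ih =>
    -- peel the last row and the last column; the boundary cells are all 1
    have hrow : ∀ P ∈ range (g + 1),
        (∑ Q ∈ range (g + 2), min (min P Q + 1) (g + 2 - max P Q))
          = (∑ Q ∈ range (g + 1), min (min P Q + 1) (g + 1 - max P Q))
            + (∑ Q ∈ range (g + 1), (if g + 1 ≤ P + Q then 1 else 0)) + 1 := by
      intro P hP
      have hP' : P ≤ g := by simpa [mem_range, Nat.lt_succ_iff] using hP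
      rw [Finset.sum_range_succ, ← Finset.sum_add_distrib]
      have hlast : min (min P (g + 1) + 1) (g + 2 - max P (g + 1)) = 1 := by omega
      rw [hlast]
      congr 1
      refine Finset.sum_congr rfl ?_
      intro Q hQ
      have hQ' : Q ≤ g := by simpa [mem_range, Nat.lt_succ_iff] using hQ
      exact window_succ g P Q hP' hQ'
    have hlastrow : (∑ Q ∈ range (g + 2), min (min (g + 1) Q + 1) (g + 2 - max (g + 1) Q)) = g + 2 := by
      have : ∀ Q ∈ range (g + 2), min (min (g + 1) Q + 1) (g + 2 - max (g + 1) Q) = 1 := by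
        intro Q hQ
        have hQ' : Q ≤ g + 1 := by simpa [mem_range, Nat.lt_succ_iff] using hQ
        omega
      rw [Finset.sum_congr rfl this]; simp
    have hsplit : (∑ P ∈ range (g + 2), ∑ Q ∈ range (g + 2), min (min P Q + 1) (g + 2 - max P Q))
        = (∑ P ∈ range (g + 1), ∑ Q ∈ range (g + 1), min (min P Q + 1) (g + 1 - max P Q))
          + (∑ P ∈ range (g + 1), ∑ Q ∈ range (g + 1), (if g + 1 ≤ P + Q then 1 else 0))
          + (g + 1) + (g + 2) := by
      rw [Finset.sum_range_succ, hlastrow, Finset.sum_congr rfl hrow, Finset.sum_add_distrib, Finset.sum_add_distrib]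
      simp
    have hA := antitriangle_twice g
    rw [show g + 1 + 1 = g + 2 from rfl, hsplit]
    nlinarith [ih, hA]

/-- **All-`g` equation count of «towers ≡ graphs».** For `g ≥ 1`:
`6 · Σ_{(P,Q) ∈ [0,g]², (P,Q) non-corner} (min (min P Q + 1) (g + 1 - max P Q) − [P = Q]) = g³ + 6g² + 5g − 12 (= (g−1)(g+3)(g+4))`. [kernel] -/
theorem six_total_rank (g : ℕ) (hg : 1 ≤ g) :
    6 * (∑ P ∈ range (g + 1), ∑ Q ∈ range (g + 1),
        (if (P = 0 ∨ P = g) ∧ (Q = 0 ∨ Q = g) then 0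
         else min (min P Q + 1) (g + 1 - max P Q) - (if P = Q then 1 else 0)))
      = g ^ 3 + 6 * g ^ 2 + 5 * g - 12 := by
  -- pointwise: summand + [corner ∨ P = Q] = window value
  have hpt : ∀ P ∈ range (g + 1), ∀ Q ∈ range (g + 1),
      (if (P = 0 ∨ P = g) ∧ (Q = 0 ∨ Q = g) then 0
         else min (min P Q + 1) (g + 1 - max P Q) - (if P = Q then 1 else 0))
        + (if ((P = 0 ∨ P = g) ∧ (Q = 0 ∨ Q = g)) ∨ P = Q then 1 else 0)
        = min (min P Q + 1) (g + 1 - max P Q) := by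
    intro P hP Q hQ
    have hP' : P ≤ g := by simpa [mem_range, Nat.lt_succ_iff] using hP
    have hQ' : Q ≤ g := by simpa [mem_range, Nat.lt_succ_iff] using hQ
    split_ifs <;> omega
  -- the correction count: Σ [corner ∨ diagonal] = g + 3
  have hcorr_row : ∀ P ∈ range (g + 1),
      (∑ Q ∈ range (g + 1), (if ((P = 0 ∨ P = g) ∧ (Q = 0 ∨ Q = g)) ∨ P = Q then 1 else 0))
        = (if P = 0 ∨ P = g then 2 else 1) := by
    intro P hP
    have hP' : P ≤ g := by simpa [mem_range, Nat.lt_succ_iff] using hP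
    rw [Finset.sum_boole, Nat.cast_id]
    by_cases h0 : P = 0 ∨ P = g
    · rw [if_pos h0]
      have : (range (g + 1)).filter (fun Q => ((P = 0 ∨ P = g) ∧ (Q = 0 ∨ Q = g)) ∨ P = Q) = {0, g} := by
        ext Q; simp only [mem_filter, mem_range, mem_insert, mem_singleton]; omega
      rw [this, card_insert_of_notMem (by simp; omega), card_singleton]
    · rw [if_neg h0]
      have : (range (g + 1)).filter (fun Q => ((P = 0 ∨ P = g) ∧ (Q = 0 ∨ Q = g)) ∨ P = Q) = {P} := by
        ext Q; simp only [mem_filter, mem_range, mem_singleton]; omega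
      rw [this, card_singleton]
  have hcorr : (∑ P ∈ range (g + 1), ∑ Q ∈ range (g + 1),
      (if ((P = 0 ∨ P = g) ∧ (Q = 0 ∨ Q = g)) ∨ P = Q then 1 else 0)) = g + 3 := by
    rw [Finset.sum_congr rfl hcorr_row]
    have h2 : ∀ P ∈ range (g + 1), (if P = 0 ∨ P = g then 2 else 1) = 1 + (if P = 0 ∨ P = g then 1 else 0) := by
      intro P _; split_ifs <;> rfl
    rw [Finset.sum_congr rfl h2, Finset.sum_add_distrib, Finset.sum_boole]
    have : (range (g + 1)).filter (fun P => P = 0 ∨ P = g) = {0, g} := by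
      ext P; simp only [mem_filter, mem_range, mem_insert, mem_singleton]; omega
    simp only [sum_const, card_range, smul_eq_mul, mul_one, Nat.cast_id, this]
    rw [card_insert_of_notMem (by simp; omega), card_singleton]
  -- assemble: 6·(Σ summand) + 6·(g+3) = (g+1)(g+2)(g+3)
  have hsum : (∑ P ∈ range (g + 1), ∑ Q ∈ range (g + 1),
        (if (P = 0 ∨ P = g) ∧ (Q = 0 ∨ Q = g) then 0
         else min (min P Q + 1) (g + 1 - max P Q) - (if P = Q then 1 else 0)))
      + (g + 3)
      = ∑ P ∈ range (g + 1), ∑ Q ∈ range (g + 1), min (min P Q + 1) (g + 1 - max P Q) := by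
    rw [← hcorr, ← Finset.sum_add_distrib]
    refine Finset.sum_congr rfl ?_
    intro P hP
    rw [← Finset.sum_add_distrib]
    exact Finset.sum_congr rfl (fun Q hQ => hpt P hP Q hQ)
  have hW := six_sum_window g
  rw [← hsum] at hW
  -- 6 S + 6 (g+3) = (g+1)(g+2)(g+3) ⇒ 6 S = g³ + 6 g² + 5 g − 12
  have h12 : 12 ≤ g ^ 3 + 6 * g ^ 2 + 5 * g := by nlinarith
  zify [h12] at hW ⊢
  nlinarith [hW]

/-- **The printed values** `g = 4, 6, 8, 10 ↦ 28, 75, 154, 273` (t-4 g32 l.26135; code A (B) 28 ∕ 75 ∕ 154), evaluated DIRECTLY by the kernel — an independent check of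
`six_total_rank` at these four `g` (168 ∕ 450 ∕ 924 ∕ 1638 = 6 × the values). [kernel, `decide`] -/
theorem total_rank_values :
    (∑ P ∈ range 5, ∑ Q ∈ range 5,
        (if (P = 0 ∨ P = 4) ∧ (Q = 0 ∨ Q = 4) then 0 else min (min P Q + 1) (4 + 1 - max P Q) - (if P = Q then 1 else 0))) = 28 ∧
    (∑ P ∈ range 7, ∑ Q ∈ range 7,
        (if (P = 0 ∨ P = 6) ∧ (Q = 0 ∨ Q = 6) then 0 else min (min P Q + 1) (6 + 1 - max P Q) - (if P = Q then 1 else 0))) = 75 ∧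
    (∑ P ∈ range 9, ∑ Q ∈ range 9,
        (if (P = 0 ∨ P = 8) ∧ (Q = 0 ∨ Q = 8) then 0 else min (min P Q + 1) (8 + 1 - max P Q) - (if P = Q then 1 else 0))) = 154 ∧
    (∑ P ∈ range 11, ∑ Q ∈ range 11,
        (if (P = 0 ∨ P = 10) ∧ (Q = 0 ∨ Q = 10) then 0 else min (min P Q + 1) (10 + 1 - max P Q) - (if P = Q then 1 else 0))) = 273 := by
  refine ⟨by decide, by decide, by decide, by decide⟩

end Summit.Ventures.HSemireg.TowerRankLaw
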